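import Summits.AnomalousDissipation.AnomalousDissipation.Theorems.SolenoidalFractalHomogenisationLagrangianStepSidebandXScalars
import HarnessLib

/-!
# K1L_D `LagrangianRenormalisationStepDesign` (stmt-AnomalousDissipation-27980), `stub_D1_V0R` (ruling D27-1), brick T8d-(e), part 2a: THE RESIDUAL
# SIZE `√ρ₂ ≤ s·(ν + ξ')·ξ/ν` AND THE RESPONSE SIZE `C_N ≤ A_N/ν` ON THE CLAUSE WINDOW, with `ν`-INDEPENDENT constants
# (helper; `--kind proof --supports stmt-AnomalousDissipation-27980 --as helper`)

Summits-side helper file of route `SolenoidalFractalHomogenisation` (prover seat `ad-k1l-cellLawV-w1` g8; 0 sorry, no defs, no named facts; pure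
real arithmetic on ABSTRACT ATOMS, instantiated by the assembly of `stub_D1_V0R`).  Atoms: `ξ = |ℓ|/n`, `ξ' = |ℓ|⌈K/ν⌉₊/n` (`ξ ≤ ν·ξ'`, `ξ' ≤ 1`),
`l` = the `NearIso` lower constant of the clause tensor `𝔸` (`ν·lo/Λ ≤ l`), `hb = hi_𝔸 + β_𝔸/2 ≤ ν·hb₀`, `CN = xiCN W₁ l ≤ AN/ν`, `Cf = xiCf W₁`,
the word sums `D₁, D₂, A₂, Cs`, `k = k₀`, box size `R ≥ ν⁻³`.
* §1 `sqrt_rho_le` — the square root `√ρ₂` of `…SidebandXResidualBound.residualX_norm_le_single` is `≤ s·(ν + ξ')·ξ/ν` with `s` free of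
  `ν, ξ, ξ', l, R` (monotone substitution of the extreme atoms `rho_at_extremes_eq`, then monomial bookkeeping `monomials_le`:
  `ξ⁴/ν², ξ⁴/ν⁴, ξ⁶/ν⁶ ≤ ξ'²(ξ/ν)²`);
* §2 `one_div_min_le_of_window` — `1/min(1,4π²l) ≤ (1 + Λ/(4π²lo))/ν`, i.e. `C_N(l) ≤ A_N/ν` with `A_N = 2C_f(1 + Λ/(4π²lo))`.
NOT a proof of any registered stub, of K1L_D, or of anomalous dissipation; rung F-D1.A0 infrastructure.
-/

set_option linter.dupNamespace false

noncomputable section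

namespace Summit.AnomalousDissipation.AnomalousDissipation.Theorems.SolenoidalFractalHomogenisation.LagrangianStep.Sideband

/-! ## §1 The residual size `√ρ₂` -/

/-- `1/l ≤ Λ/(ν·lo)` on the clause window `ν·lo/Λ ≤ l`. [folklore] -/
theorem one_div_le_of_window {l ν lo Λ : ℝ} (hl : 0 < l) (hν : 0 < ν) (hlo : 0 < lo) (hΛ : 0 < Λ) (h : ν * (lo / Λ) ≤ l) :
    1 / l ≤ Λ / lo / ν := by
  rw [div_div, div_le_div_iff₀ hl (by positivity)]
  calc 1 * (lo * ν) = ν * (lo / Λ) * Λ := by field_simp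
    _ ≤ l * Λ := by gcongr
    _ = Λ * l := mul_comm _ _

/-- Monomial bookkeeping: with `u = ξ/ν ≤ ξ' ≤ 1` and `ξ ≤ ξ'`, the monomials `ξ⁴/ν²`, `ξ⁴/ν⁴`, `ξ⁶/ν⁶` are `≤ ξ'²·(ξ/ν)²`. [folklore] -/
theorem monomials_le {ξ ξ' ν : ℝ} (hν : 0 < ν) (hν1 : ν ≤ 1) (hξ : 0 ≤ ξ) (hξν : ξ ≤ ν * ξ') (hξ'1 : ξ' ≤ 1) :
    ξ ^ 4 / ν ^ 2 ≤ ξ' ^ 2 * (ξ / ν) ^ 2 ∧ ξ ^ 4 / ν ^ 4 ≤ ξ' ^ 2 * (ξ / ν) ^ 2 ∧ ξ ^ 6 / ν ^ 6 ≤ ξ' ^ 2 * (ξ / ν) ^ 2 := by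
  have hξ' : 0 ≤ ξ' := by nlinarith
  have hu : ξ / ν ≤ ξ' := by rw [div_le_iff₀ hν]; linarith
  have hu0 : 0 ≤ ξ / ν := by positivity
  have hξξ' : ξ ≤ ξ' := hξν.trans (by nlinarith)
  refine ⟨?_, ?_, ?_⟩
  · have e : ξ ^ 4 / ν ^ 2 = ξ ^ 2 * (ξ / ν) ^ 2 := by field_simp
    rw [e]
    exact mul_le_mul_of_nonneg_right (pow_le_pow_left₀ hξ hξξ' 2) (sq_nonneg _)
  · have e : ξ ^ 4 / ν ^ 4 = (ξ / ν) ^ 2 * (ξ / ν) ^ 2 := by field_simp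
    rw [e]
    exact mul_le_mul_of_nonneg_right (pow_le_pow_left₀ hu0 hu 2) (sq_nonneg _)
  · have e : ξ ^ 6 / ν ^ 6 = (ξ / ν) ^ 4 * (ξ / ν) ^ 2 := by field_simp
    rw [e]
    refine mul_le_mul_of_nonneg_right ?_ (sq_nonneg _)
    calc (ξ / ν) ^ 4 ≤ ξ' ^ 4 := pow_le_pow_left₀ hu0 hu 4
      _ ≤ ξ' ^ 2 := pow_le_pow_of_le_one hξ' hξ'1 (by norm_num)


/-- The explicit value of the majorant of `ρ₂` at the extreme atoms `l = ν·lo/Λ`, `CN = AN/ν`, `hb = ν·hb₀`, `R = ν⁻³`. [folklore] -/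
theorem rho_at_extremes_eq {ξ ν lo Λ hb₀ AN Cf D₁ D₂ A₂ Cs k : ℝ} (hν : 0 < ν) (hlo : 0 < lo) (hΛ : 0 < Λ) :
    (ξ ^ 4 * ((AN / ν) ^ 2 * ((32 * Real.pi ^ 2 * 534 ^ 2 * (ν * hb₀) ^ 2 / (ν * (lo / Λ)) + 24 * D₁ ^ 2 / (Real.pi ^ 2 * (ν * (lo / Λ)))) +
          2 * (12 * ((AN / ν) * Cf) ^ 2 / (Real.pi ^ 2 * (ν * (lo / Λ)))) * ξ ^ 2) +
        (6 * D₂ ^ 2 / (Real.pi ^ 2 * (ν * (lo / Λ))) + 12 * ((AN / ν) * (4 * Real.pi ^ 2 * (ν * hb₀))) ^ 2 / (Real.pi ^ 2 * (ν * (lo / Λ))))) +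
        2 / (ν * (lo / Λ)) * ((4 * k * A₂ * (k * A₂ * (64 * Cs ^ 2 / (Real.pi ^ 2 * (ν * (lo / Λ)) ^ 2)) /
          (Real.pi ^ 2 * (ν * (lo / Λ)) ^ 2 * (1 / ν ^ 3) ^ 2))) * ξ ^ 2)) / (Real.pi ^ 2 * (ν * (lo / Λ)) / 4) =
      4 * (Λ / lo) ^ 2 / Real.pi ^ 2 *
          ((32 * Real.pi ^ 2 * 534 ^ 2 + 192 * Real.pi ^ 2) * AN ^ 2 * hb₀ ^ 2 * (ξ ^ 4 / ν ^ 2) + 24 * AN ^ 2 * D₁ ^ 2 / Real.pi ^ 2 * (ξ ^ 4 / ν ^ 4) +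
            24 * AN ^ 4 * Cf ^ 2 / Real.pi ^ 2 * (ξ ^ 6 / ν ^ 6) + 6 * D₂ ^ 2 / Real.pi ^ 2 * (ξ ^ 4 / ν ^ 2)) +
        2048 * k ^ 2 * A₂ ^ 2 * Cs ^ 2 * (Λ / lo) ^ 6 / Real.pi ^ 6 * ξ ^ 2 := by
  have hπ : Real.pi ≠ 0 := Real.pi_pos.ne'
  field_simp
  ring

/-- **`√ρ₂ ≤ s·(ν + ξ')·ξ/ν`**: the square root of the residual-energy level `ρ₂` of `…SidebandXResidualBound.residualX_norm_le_single`
(atoms as in the module docstring) is bounded by `s·(ν + ξ')·(ξ/ν)` with `s` free of `ν, ξ, ξ', l, R`.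
[cite: SandersVerhulstMurdock2007, Lemma 5.2.7 (linear case)] -/
theorem sqrt_rho_le {ξ ξ' ν lo Λ l hb hb₀ CN AN Cf D₁ D₂ A₂ Cs k R : ℝ}
    (hν : 0 < ν) (hν1 : ν ≤ 1) (hlo : 0 < lo) (hΛ : 0 < Λ) (hl : 0 < l) (hwin : ν * (lo / Λ) ≤ l)
    (hξ : 0 ≤ ξ) (hξν : ξ ≤ ν * ξ') (hξ'1 : ξ' ≤ 1)
    (hhb : 0 ≤ hb) (hhb₀ : hb ≤ ν * hb₀) (hCN : 0 ≤ CN) (hAN : CN ≤ AN / ν) (hCf : 0 ≤ Cf)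
    (hA₂ : 0 ≤ A₂) (hk : 0 ≤ k) (hR : 0 < R) (hRν : 1 ≤ ν ^ 3 * R) :
    Real.sqrt ((ξ ^ 4 * (CN ^ 2 * ((32 * Real.pi ^ 2 * 534 ^ 2 * hb ^ 2 / l + 24 * D₁ ^ 2 / (Real.pi ^ 2 * l)) +
          2 * (12 * (CN * Cf) ^ 2 / (Real.pi ^ 2 * l)) * ξ ^ 2) +
        (6 * D₂ ^ 2 / (Real.pi ^ 2 * l) + 12 * (CN * (4 * Real.pi ^ 2 * hb)) ^ 2 / (Real.pi ^ 2 * l))) +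
        2 / l * ((4 * k * A₂ * (k * A₂ * (64 * Cs ^ 2 / (Real.pi ^ 2 * l ^ 2)) / (Real.pi ^ 2 * l ^ 2 * R ^ 2))) * ξ ^ 2)) /
        (Real.pi ^ 2 * l / 4)) ≤
      Real.sqrt (4 * (Λ / lo) ^ 2 / Real.pi ^ 2 *
            ((32 * Real.pi ^ 2 * 534 ^ 2 + 192 * Real.pi ^ 2) * AN ^ 2 * hb₀ ^ 2 + 24 * AN ^ 2 * D₁ ^ 2 / Real.pi ^ 2 +
              24 * AN ^ 4 * Cf ^ 2 / Real.pi ^ 2 + 6 * D₂ ^ 2 / Real.pi ^ 2) +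
          2048 * k ^ 2 * A₂ ^ 2 * Cs ^ 2 * (Λ / lo) ^ 6 / Real.pi ^ 6) * ((ν + ξ') * (ξ / ν)) := by
  have hξ' : 0 ≤ ξ' := by nlinarith
  have hAN0 : 0 ≤ AN := by
    have := hCN.trans hAN; rwa [le_div_iff₀ hν, zero_mul] at this
  have hhb₀0 : 0 ≤ hb₀ := by nlinarith
  have hl₀ : 0 < ν * (lo / Λ) := by positivity
  have hR₀ : 1 / ν ^ 3 ≤ R := by rw [div_le_iff₀ (by positivity)]; linarith
  have hR₀' : 0 < 1 / ν ^ 3 := by positivity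
  -- step 1: monotone substitution of the extreme atoms
  have h1 : (ξ ^ 4 * (CN ^ 2 * ((32 * Real.pi ^ 2 * 534 ^ 2 * hb ^ 2 / l + 24 * D₁ ^ 2 / (Real.pi ^ 2 * l)) +
          2 * (12 * (CN * Cf) ^ 2 / (Real.pi ^ 2 * l)) * ξ ^ 2) +
        (6 * D₂ ^ 2 / (Real.pi ^ 2 * l) + 12 * (CN * (4 * Real.pi ^ 2 * hb)) ^ 2 / (Real.pi ^ 2 * l))) +
        2 / l * ((4 * k * A₂ * (k * A₂ * (64 * Cs ^ 2 / (Real.pi ^ 2 * l ^ 2)) / (Real.pi ^ 2 * l ^ 2 * R ^ 2))) * ξ ^ 2)) /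
        (Real.pi ^ 2 * l / 4) ≤
      (ξ ^ 4 * ((AN / ν) ^ 2 * ((32 * Real.pi ^ 2 * 534 ^ 2 * (ν * hb₀) ^ 2 / (ν * (lo / Λ)) + 24 * D₁ ^ 2 / (Real.pi ^ 2 * (ν * (lo / Λ)))) +
          2 * (12 * ((AN / ν) * Cf) ^ 2 / (Real.pi ^ 2 * (ν * (lo / Λ)))) * ξ ^ 2) +
        (6 * D₂ ^ 2 / (Real.pi ^ 2 * (ν * (lo / Λ))) + 12 * ((AN / ν) * (4 * Real.pi ^ 2 * (ν * hb₀))) ^ 2 / (Real.pi ^ 2 * (ν * (lo / Λ))))) +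
        2 / (ν * (lo / Λ)) * ((4 * k * A₂ * (k * A₂ * (64 * Cs ^ 2 / (Real.pi ^ 2 * (ν * (lo / Λ)) ^ 2)) /
          (Real.pi ^ 2 * (ν * (lo / Λ)) ^ 2 * (1 / ν ^ 3) ^ 2))) * ξ ^ 2)) / (Real.pi ^ 2 * (ν * (lo / Λ)) / 4) := by
    gcongr
  rw [rho_at_extremes_eq hν hlo hΛ] at h1
  -- step 2: the monomials
  obtain ⟨m1, m2, m3⟩ := monomials_le hν hν1 hξ hξν hξ'1
  have hu2 : ξ' ^ 2 * (ξ / ν) ^ 2 ≤ ((ν + ξ') * (ξ / ν)) ^ 2 := by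
    rw [mul_pow]
    exact mul_le_mul_of_nonneg_right (pow_le_pow_left₀ hξ' (by linarith) 2) (sq_nonneg _)
  have hξ2 : ξ ^ 2 ≤ ((ν + ξ') * (ξ / ν)) ^ 2 := by
    have e : ξ ^ 2 = (ν * (ξ / ν)) ^ 2 := by field_simp
    rw [e, mul_pow, mul_pow]
    exact mul_le_mul_of_nonneg_right (pow_le_pow_left₀ hν.le (by linarith) 2) (sq_nonneg _)
  have m1' := m1.trans hu2
  have m2' := m2.trans hu2
  have m3' := m3.trans hu2
  have h2 : 4 * (Λ / lo) ^ 2 / Real.pi ^ 2 *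
          ((32 * Real.pi ^ 2 * 534 ^ 2 + 192 * Real.pi ^ 2) * AN ^ 2 * hb₀ ^ 2 * (ξ ^ 4 / ν ^ 2) + 24 * AN ^ 2 * D₁ ^ 2 / Real.pi ^ 2 * (ξ ^ 4 / ν ^ 4) +
            24 * AN ^ 4 * Cf ^ 2 / Real.pi ^ 2 * (ξ ^ 6 / ν ^ 6) + 6 * D₂ ^ 2 / Real.pi ^ 2 * (ξ ^ 4 / ν ^ 2)) +
        2048 * k ^ 2 * A₂ ^ 2 * Cs ^ 2 * (Λ / lo) ^ 6 / Real.pi ^ 6 * ξ ^ 2 ≤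
      4 * (Λ / lo) ^ 2 / Real.pi ^ 2 *
          ((32 * Real.pi ^ 2 * 534 ^ 2 + 192 * Real.pi ^ 2) * AN ^ 2 * hb₀ ^ 2 * ((ν + ξ') * (ξ / ν)) ^ 2 +
            24 * AN ^ 2 * D₁ ^ 2 / Real.pi ^ 2 * ((ν + ξ') * (ξ / ν)) ^ 2 +
            24 * AN ^ 4 * Cf ^ 2 / Real.pi ^ 2 * ((ν + ξ') * (ξ / ν)) ^ 2 + 6 * D₂ ^ 2 / Real.pi ^ 2 * ((ν + ξ') * (ξ / ν)) ^ 2) +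
        2048 * k ^ 2 * A₂ ^ 2 * Cs ^ 2 * (Λ / lo) ^ 6 / Real.pi ^ 6 * ((ν + ξ') * (ξ / ν)) ^ 2 := by
    gcongr
  have h3 : 4 * (Λ / lo) ^ 2 / Real.pi ^ 2 *
          ((32 * Real.pi ^ 2 * 534 ^ 2 + 192 * Real.pi ^ 2) * AN ^ 2 * hb₀ ^ 2 * ((ν + ξ') * (ξ / ν)) ^ 2 +
            24 * AN ^ 2 * D₁ ^ 2 / Real.pi ^ 2 * ((ν + ξ') * (ξ / ν)) ^ 2 +
            24 * AN ^ 4 * Cf ^ 2 / Real.pi ^ 2 * ((ν + ξ') * (ξ / ν)) ^ 2 + 6 * D₂ ^ 2 / Real.pi ^ 2 * ((ν + ξ') * (ξ / ν)) ^ 2) +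
        2048 * k ^ 2 * A₂ ^ 2 * Cs ^ 2 * (Λ / lo) ^ 6 / Real.pi ^ 6 * ((ν + ξ') * (ξ / ν)) ^ 2 =
      (4 * (Λ / lo) ^ 2 / Real.pi ^ 2 *
            ((32 * Real.pi ^ 2 * 534 ^ 2 + 192 * Real.pi ^ 2) * AN ^ 2 * hb₀ ^ 2 + 24 * AN ^ 2 * D₁ ^ 2 / Real.pi ^ 2 +
              24 * AN ^ 4 * Cf ^ 2 / Real.pi ^ 2 + 6 * D₂ ^ 2 / Real.pi ^ 2) +
          2048 * k ^ 2 * A₂ ^ 2 * Cs ^ 2 * (Λ / lo) ^ 6 / Real.pi ^ 6) * ((ν + ξ') * (ξ / ν)) ^ 2 := by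
    ring
  have hu0 : 0 ≤ (ν + ξ') * (ξ / ν) := by positivity
  calc _ ≤ Real.sqrt ((4 * (Λ / lo) ^ 2 / Real.pi ^ 2 *
            ((32 * Real.pi ^ 2 * 534 ^ 2 + 192 * Real.pi ^ 2) * AN ^ 2 * hb₀ ^ 2 + 24 * AN ^ 2 * D₁ ^ 2 / Real.pi ^ 2 +
              24 * AN ^ 4 * Cf ^ 2 / Real.pi ^ 2 + 6 * D₂ ^ 2 / Real.pi ^ 2) +
          2048 * k ^ 2 * A₂ ^ 2 * Cs ^ 2 * (Λ / lo) ^ 6 / Real.pi ^ 6) * ((ν + ξ') * (ξ / ν)) ^ 2) :=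
        Real.sqrt_le_sqrt ((h1.trans h2).trans h3.le)
    _ = _ := by rw [Real.sqrt_mul' _ (sq_nonneg _), Real.sqrt_sq hu0]


/-! ## §2 The response size `C_N` on the clause window -/

/-- `1/min(1, x) ≤ 1 + 1/x` for `x > 0`. [folklore] -/
theorem one_div_min_one_le {x : ℝ} (hx : 0 < x) : 1 / min 1 x ≤ 1 + 1 / x := by
  rcases le_total 1 x with h | h
  · rw [min_eq_left h]; have : 0 ≤ 1 / x := by positivity
    linarith
  · rw [min_eq_right h]; linarith [show (0:ℝ) ≤ 1 from zero_le_one]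

/-- **`1/min(1, 4π²l) ≤ (1 + Λ/(4π²lo))/ν`** on the clause window `ν·lo/Λ ≤ l`, `ν ≤ 1` (so `C_N(l) = 2C_f/min(1,4π²l) ≤ A_N/ν` with
`A_N = 2C_f(1 + Λ/(4π²lo))`). [folklore] -/
theorem one_div_min_le_of_window {l ν lo Λ : ℝ} (hl : 0 < l) (hν : 0 < ν) (hν1 : ν ≤ 1) (hlo : 0 < lo) (hΛ : 0 < Λ)
    (h : ν * (lo / Λ) ≤ l) : 1 / min 1 (4 * Real.pi ^ 2 * l) ≤ (1 + Λ / (4 * Real.pi ^ 2 * lo)) / ν := by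
  have hπ : 0 < 4 * Real.pi ^ 2 := by positivity
  have h1 := one_div_min_one_le (show 0 < 4 * Real.pi ^ 2 * l by positivity)
  have h2 : 1 / (4 * Real.pi ^ 2 * l) ≤ Λ / (4 * Real.pi ^ 2 * lo) / ν := by
    have hw := one_div_le_of_window hl hν hlo hΛ h
    calc 1 / (4 * Real.pi ^ 2 * l) = 1 / (4 * Real.pi ^ 2) * (1 / l) := by field_simp
      _ ≤ 1 / (4 * Real.pi ^ 2) * (Λ / lo / ν) := mul_le_mul_of_nonneg_left hw (by positivity)
      _ = Λ / (4 * Real.pi ^ 2 * lo) / ν := by field_simp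
  have h3 : (1:ℝ) ≤ 1 / ν := by rw [le_div_iff₀ hν]; linarith
  calc 1 / min 1 (4 * Real.pi ^ 2 * l) ≤ 1 + 1 / (4 * Real.pi ^ 2 * l) := h1
    _ ≤ 1 / ν + Λ / (4 * Real.pi ^ 2 * lo) / ν := add_le_add h3 h2
    _ = (1 + Λ / (4 * Real.pi ^ 2 * lo)) / ν := by ring

end Summit.AnomalousDissipation.AnomalousDissipation.Theorems.SolenoidalFractalHomogenisation.LagrangianStep.Sideband

end
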